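import Summits.NavierStokesRegularity.NavierStokesRegularity.Theorems.IntenseSetDoorsAssemblyTools
import HarnessLib

/-!
# S34 «IntenseSetDoors» — plate A34-B «BeltramiCorePowerBoundAssembly» PROVED

Summits-side proof file (theorems only) for door family S34 (nsreg-p1 g28, ROUND-32; texts of record
`r32/Sketch34.lean` c542dddc314f2f7c = tree P0 `Theorems/IntenseSetDoorsDefs.lean`):
`beltramiCorePowerBoundAssembly_holds : BeltramiCorePowerBoundAssembly`, i.e.
`ValueCutoffLowStretching → LambPairingBound → ForcedPowerGronwallSlab → BeltramiCorePowerBound`,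
BY NAME against the Prop names of P0 (V34, L34, G34 are HYPOTHESES here, not re-proved).

Proof (the glue of PLATE-AID-34 §A34-B; skeleton = A33 `enstrophyPowerBoundAssembly_holds`): exponents
`η := (√3/(4ε₀) − 1)/2`, `a₁ := (2/√3)(1+η)ε₀`, `a := max(a₁, (2c−1)/4)` (`exponentB`: `a < 1/2`,
`c < a + 1`); at `t₀ = 0` (`beltramiCorePowerBound_zero`) on every closed slab `[0, T'']`: the slice
package, the fixed-time engine `two_mul_integral_stretching_le_lamb` (V34 + L34) at the moving level
`L := ε₀/(T − s)` (so `{ε₀ < (T − s)|ω|} = {L < |ω|}` and the low coefficient is `a₁/(T − s) ≤ a/(T − s)`),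
Young `C√D√Λ ≤ νD + (C²/4ν)Λ`, the door hypothesis `Λ ≤ K⁺(T − s)^{−c}`, then G34 with
`β := C²K⁺/(4ν)`: `∫|ω(t)|² ≤ (∫|ω(0)|² T^a + βT^{a+1−c}/(a+1−c))(T − t)^{−a}` uniformly in `T''`, and
`∫⁻|∇u|²_F ≤ ∫|ω|²`; general `t₀` by time translation (`SubcriticalLamb` translates since
`T − t = (T − t₀) − (t − t₀)`).
HONEST FRAME: V34/L34/G34 are hypotheses by name; S34-B is a regularity CRITERION (subcritical Lamb
energy on the critical core ⇒ continuation); item 0056 `NoTypeII` / NS regularity NOT proved.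
-/

noncomputable section

set_option linter.dupNamespace false

open MeasureTheory Set Function Filter Metric Real InnerProductSpace
open _root_.Topology
open scoped ENNReal NNReal RealInnerProductSpace ContDiff
open Literature.Analysis Literature.Analysis.FluidPDE

namespace Summit.NavierStokesRegularity.NavierStokesRegularity.Theorems.IntenseSetDoors

-- nested operator types (second derivatives)
set_option maxSynthPendingDepth 3

/-- **A34-B at `t₀ = 0`.** Let `ν > 0`, `T > 0`, `0 < ε₀ < √3/4`, `c < 3/2`, `K` real, `(u, p)` a
classical unforced Navier–Stokes solution on `ℝ³ × [0, T)` with all `L²` Sobolev seminorms bounded on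
every `[0, T'']`, `T'' < T`, satisfying `SubcriticalLamb u T 0 ε₀ K c`. If the plates V34, L34, G34 hold
(as Props), then `∫⁻|∇u(t)|²_F ≤ K'(T − t)^{−a}` on `[0, T)` with `K' ≥ 0` and
`a = max((2/√3)(1+η)ε₀, (2c−1)/4) < 1/2`. [folklore] -/
theorem beltramiCorePowerBound_zero (hV : ValueCutoffLowStretching) (hL : LambPairingBound)
    (hGr : ForcedPowerGronwallSlab) {ν T ε₀ K c : ℝ} (hν : 0 < ν) (hTpos : 0 < T) (hε₀ : 0 < ε₀)
    (hε₁ : ε₀ < Real.sqrt 3 / 4) (hc : c < 3 / 2)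
    {u : ℝ → (EuclideanSpace ℝ (Fin 3)) → (EuclideanSpace ℝ (Fin 3))}
    {p : ℝ → (EuclideanSpace ℝ (Fin 3)) → ℝ}
    (hsol : IsClassicalNSSolutionOn (Ico 0 T) ν 0 u p)
    (hreg : ∀ T'' < T, HasBoundedSobolevNormsOn (Icc 0 T'') u)
    (hlamb : SubcriticalLamb u T 0 ε₀ K c) :
    ∃ K' a : ℝ, 0 ≤ K' ∧ a < 1 / 2 ∧ ∀ t ∈ Ico 0 T,
      (∫⁻ x, ENNReal.ofReal (frobeniusNormSq (fderiv ℝ (u t) x))) ≤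
        ENNReal.ofReal (K' * (T - t) ^ (-a)) := by
  obtain ⟨hη, ha₁0, ha₁a, ha, hca⟩ := exponentB hε₀ hε₁ hc
  set η : ℝ := (Real.sqrt 3 / (4 * ε₀) - 1) / 2 with hηdef
  set a₁ : ℝ := 2 / Real.sqrt 3 * (1 + η) * ε₀ with ha₁def
  set a : ℝ := max a₁ ((2 * c - 1) / 4) with hadef
  have ha0 : 0 ≤ a := ha₁0.trans ha₁a
  have hac : 0 < a + 1 - c := by linarith
  obtain ⟨C, hC0, hC⟩ := hL η hη
  set Kp : ℝ := max K 0 with hKp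
  have hKp0 : 0 ≤ Kp := le_max_right _ _
  have hKKp : K ≤ Kp := le_max_left _ _
  set β : ℝ := C ^ 2 / (4 * ν) * Kp with hβdef
  have hβ0 : 0 ≤ β := by positivity
  set Y₀ : ℝ := ∫ x, ‖curl (u 0) x‖ ^ 2 with hY₀
  have hY₀0 : 0 ≤ Y₀ := integral_nonneg fun x => sq_nonneg _
  have hTa : 0 ≤ T ^ a := Real.rpow_nonneg hTpos.le _
  have hTac : 0 ≤ T ^ (a + 1 - c) := Real.rpow_nonneg hTpos.le _
  refine ⟨Y₀ * T ^ a + β * T ^ (a + 1 - c) / (a + 1 - c), a, by positivity, ha, ?_⟩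
  intro t ht
  -- a closed slab containing `t`
  set T'' : ℝ := (t + T) / 2 with hT''def
  have htT'' : t < T'' := by rw [hT''def]; linarith [ht.2]
  have hT''T : T'' < T := by rw [hT''def]; linarith [ht.2]
  have hT''pos : 0 < T'' := lt_of_le_of_lt ht.1 htT''
  have hS : IsClassicalNSSolutionOn (Icc 0 T'') ν 0 u p :=
    hsol.mono (Icc_subset_Ico_right hT''T) (uniqueDiffOn_Icc hT''pos)
  have hB : HasBoundedSobolevNormsOn (Icc 0 T'') u := hreg T'' hT''T
  have htS : t ∈ Icc 0 T'' := ⟨ht.1, htT''.le⟩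
  obtain ⟨B₁, B₂, -, -, hpk⟩ := slice_package hS hB
  -- the stretching inequality on the slab (V34 + L34 + Young + the door hypothesis)
  have hstrS : ∀ s ∈ Icc 0 T'',
      2 * ∫ x, ⟪curl (u s) x, fderiv ℝ (u s) x (curl (u s) x)⟫ ≤
        ν * (∫ x, frobeniusNormSq (fderiv ℝ (curl (u s)) x)) +
          a / (T - s) * (∫ x, ‖curl (u s) x‖ ^ 2) + β * (T - s) ^ (-c) := by
    intro s hs
    have hsT : s ∈ Ico 0 T := ⟨hs.1, hs.2.trans_lt hT''T⟩
    have hTs : 0 < T - s := by linarith [hsT.2]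
    obtain ⟨hv3, hdiv, i0, i1, i2, hB₁, hB₂⟩ := hpk s hs
    have hv2 : ContDiff ℝ 2 (u s) := hv3.of_le (by norm_cast)
    have hωc : Continuous (curl (u s)) := continuous_curl (hv2.of_le (by norm_num))
    have hL : 0 < ε₀ / (T - s) := div_pos hε₀ hTs
    have hmain := two_mul_integral_stretching_le_lamb hV hη hC hL hv2 hdiv i0 i1 i2 hB₂ hB₁
    -- the quantities
    set D : ℝ := ∫ x, frobeniusNormSq (fderiv ℝ (curl (u s)) x) with hD
    set Y : ℝ := ∫ x, ‖curl (u s) x‖ ^ 2 with hY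
    set Λ : ℝ := ∫ x in {x | ε₀ / (T - s) < ‖curl (u s) x‖}, ‖cross (u s x) (curl (u s) x)‖ ^ 2
      with hΛ
    have hD0 : 0 ≤ D := integral_nonneg fun x => frobeniusNormSq_nonneg _
    have hY0 : 0 ≤ Y := integral_nonneg fun x => sq_nonneg _
    have hSm : MeasurableSet {x | ε₀ / (T - s) < ‖curl (u s) x‖} :=
      (isOpen_lt continuous_const hωc.norm).measurableSet
    have hΛ0 : 0 ≤ Λ := setIntegral_nonneg hSm fun x _ => sq_nonneg _
    -- the door hypothesis at time `s`
    have hΛle : Λ ≤ Kp * (T - s) ^ (-c) := by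
      have hset : {x | ε₀ / (T - s) < ‖curl (u s) x‖} = {x | ε₀ < (T - s) * ‖curl (u s) x‖} := by
        ext x
        simp only [mem_setOf_eq]
        rw [div_lt_iff₀ hTs, mul_comm]
      rw [hΛ, hset]
      have hcont : Continuous fun x => cross (u s x) (curl (u s) x) :=
        crossCLM.continuous₂.comp₂ hv2.continuous hωc
      exact setIntegral_norm_sq_le_of_lintegral_le hcont (hlamb s hsT)
        (mul_le_mul_of_nonneg_right hKKp (Real.rpow_nonneg hTs.le _))
        (mul_nonneg hKp0 (Real.rpow_nonneg hTs.le _))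
    -- Young
    have hyoung : C * Real.sqrt D * Real.sqrt Λ ≤ ν * D + C ^ 2 / (4 * ν) * Λ := by
      have key : C * Real.sqrt D * Real.sqrt Λ ≤
          ν * Real.sqrt D ^ 2 + C ^ 2 / (4 * ν) * Real.sqrt Λ ^ 2 := by
        rw [← sub_nonneg]
        have hid : ν * Real.sqrt D ^ 2 + C ^ 2 / (4 * ν) * Real.sqrt Λ ^ 2 -
            C * Real.sqrt D * Real.sqrt Λ =
            (2 * ν * Real.sqrt D - C * Real.sqrt Λ) ^ 2 / (4 * ν) := by
          field_simp
          ring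
        rw [hid]
        positivity
      rwa [Real.sq_sqrt hD0, Real.sq_sqrt hΛ0] at key
    have hcoef : 2 / Real.sqrt 3 * ((1 + η) * (ε₀ / (T - s))) = a₁ / (T - s) := by
      rw [ha₁def]
      ring
    have ha1le : a₁ / (T - s) * Y ≤ a / (T - s) * Y :=
      mul_le_mul_of_nonneg_right (div_le_div_of_nonneg_right ha₁a hTs.le) hY0
    have hν4 : 0 ≤ C ^ 2 / (4 * ν) := by positivity
    calc 2 * ∫ x, ⟪curl (u s) x, fderiv ℝ (u s) x (curl (u s) x)⟫
        ≤ 2 / Real.sqrt 3 * ((1 + η) * (ε₀ / (T - s))) * Y + C * Real.sqrt D * Real.sqrt Λ := hmain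
      _ ≤ a / (T - s) * Y + (ν * D + C ^ 2 / (4 * ν) * Λ) := by
          rw [hcoef]; exact add_le_add ha1le hyoung
      _ ≤ a / (T - s) * Y + (ν * D + C ^ 2 / (4 * ν) * (Kp * (T - s) ^ (-c))) := by
          gcongr
      _ = ν * D + a / (T - s) * Y + β * (T - s) ^ (-c) := by rw [hβdef]; ring
  -- the forced power Grönwall inequality on the slab
  have hYt := hGr ν T T'' a β c hν hT''pos hT''T ha0 hβ0 hca u p hS hB hstrS t htS
  -- `∫⁻|∇u|²_F ≤ ∫|ω|²`
  obtain ⟨hv3, hdiv, i0, i1, -, -, -⟩ := hpk t htS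
  have hYint : Integrable fun x => ‖curl (u t) x‖ ^ 2 := by
    refine (i1.const_mul (‖curlCLM‖ ^ 2)).mono'
      (((continuous_curl (hv3.of_le (by norm_cast))).norm.pow 2).aestronglyMeasurable)
      (Eventually.of_forall fun x => ?_)
    rw [Real.norm_of_nonneg (sq_nonneg _), ← mul_pow]
    exact pow_le_pow_left₀ (norm_nonneg _) (norm_curl_le (u t) x) 2
  exact lintegral_frobeniusNormSq_le_of_integral_curl_sq_le (hv3.of_le (by norm_cast)) hdiv i0 hYint hYt

/-- **Plate A34-B «BeltramiCorePowerBoundAssembly» PROVED**: `ValueCutoffLowStretching →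
LambPairingBound → ForcedPowerGronwallSlab → BeltramiCorePowerBound` (the Prop names of
`Theorems/IntenseSetDoorsDefs.lean`). Proof: translate time by `t₀`
(`IsClassicalNSSolutionOn.translate_Ico_zero`; the Sobolev bounds and `SubcriticalLamb` translate, the
latter because `T − t = (T − t₀) − (t − t₀)`), apply `beltramiCorePowerBound_zero` on `[0, T − t₀)`,
translate back. [folklore] -/
theorem beltramiCorePowerBoundAssembly_holds : BeltramiCorePowerBoundAssembly := by
  intro hV hL hGr ν T t₀ ε₀ K c hν ht₀ ht₀T hε₀ hε₁ hc u p hsol hreg hlamb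
  have hTt : 0 < T - t₀ := by linarith
  have hsol' : IsClassicalNSSolutionOn (Ico 0 (T - t₀)) ν 0 (fun t => u (t + t₀))
      (fun t => p (t + t₀)) := hsol.translate_Ico_zero ht₀
  have hreg' : ∀ T'' < T - t₀, HasBoundedSobolevNormsOn (Icc 0 T'') (fun t => u (t + t₀)) := by
    intro T'' hT'' n
    obtain ⟨C, hC⟩ := hreg (T'' + t₀) (by linarith) n
    exact ⟨C, fun t ht => hC (t + t₀) ⟨by linarith [ht.1], by linarith [ht.2]⟩⟩
  have hlamb' : SubcriticalLamb (fun t => u (t + t₀)) (T - t₀) 0 ε₀ K c := by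
    intro t ht
    have h := hlamb (t + t₀) ⟨by linarith [ht.1], by linarith [ht.2]⟩
    have hTT : T - (t + t₀) = T - t₀ - t := by ring
    simp only [hTT] at h
    exact h
  obtain ⟨K', a, hK0, ha, hF⟩ :=
    beltramiCorePowerBound_zero hV hL hGr hν hTt hε₀ hε₁ hc hsol' hreg' hlamb'
  refine ⟨K', a, hK0, ha, fun t ht => ?_⟩
  have h := hF (t - t₀) ⟨by linarith [ht.1], by linarith [ht.2]⟩
  have hTT : T - t₀ - (t - t₀) = T - t := by ring
  simp only [sub_add_cancel, hTT] at h
  exact h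

end Summit.NavierStokesRegularity.NavierStokesRegularity.Theorems.IntenseSetDoors

end
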